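import Literature.AlgebraicGeometry.Motives.TensorCentreCartier
import Literature.AlgebraicGeometry.Motives.HypersurfaceFieldPoints
import Literature.AlgebraicGeometry.Motives.AbelianVarietyRigidity
import Literature.AlgebraicGeometry.Motives.SegreEmbedding
import Literature.AlgebraicGeometry.Resolution.StrictTransformPersistence
import HarnessLib

/-!
# Sub-centres over rational points: the slices `{p} × W ↪ X ⊗ W`

Topic `Literature/AlgebraicGeometry/Motives`; theorem-only. For a rational point
`p : Spec k ⟶ X` of a `k`-scheme (`p ≫ (X → Spec k) = 𝟙`) and a `k`-scheme `W`, the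
**slice** `h_p = (p ∘ (W → Spec k), 𝟙) : W ↪ X ⊗ W` (`= λ⁻¹ ≫ (p ▷ W)`) is a closed immersion
(for `X` separated) with image `pr₁⁻¹{p}`,
and it is killed by every ideal sheaf killed by `p` — in particular by `ker g` for a closed
immersion `g : Y ↪ X` through whose image `p` passes (`p` factors through the reduced `Y`,
`liftOfRangeSubset`). These slices are the components `Bⱼ = Xʳₘ × {pⱼ} (× W)` of Shioda–Katsura's
blow-up centre `Xʳₘ × X⁰ₘ` over the `m` points `pⱼ` of `X⁰ₘ` (Tôhoku Math. J. 31 (1979), (1.6)),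
as closed immersions `h : Y₂ ↪ X₂` feeding `Motives/TensorCentreHosts`.

## References

* T. Shioda, T. Katsura, On Fermat varieties, Tôhoku Math. J. 31 (1979) 97–115, §1 (1.6).
  [ShiodaKatsura1979]
-/

noncomputable section

open CategoryTheory CategoryTheory.Limits AlgebraicGeometry MonoidalCategory

namespace Literature.AlgebraicGeometry.Motives

open Literature.AlgebraicGeometry.Resolution

variable {k : Type} [Field k] {X : SchemeOver k} (p : Spec (.of k) ⟶ X.left) (hp : p ≫ X.hom = 𝟙 _)
  (W : SchemeOver k)

include hp in
/-- The square of the slice: `(W → Spec k → X) → Spec k` is `W → Spec k`. [folklore] -/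
theorem slice_condition : (W.hom ≫ p) ≫ X.hom = 𝟙 W.left ≫ W.hom := by
  rw [Category.assoc, hp, Category.id_comp, Category.comp_id]

/-! The slice `h_p : W → X ⊗ W` over the rational point `p` is written
`pullback.lift (W.hom ≫ p) (𝟙 W.left) (slice_condition p hp W) : W.left ⟶ pullback X.hom W.hom`
(`= ((λ_ W).inv ≫ p ▷ W).left`); as a `k`-morphism it is `Over.homMk` of it (`slice_comp_hom`). -/

/-- `h_p ≫ pr₁ = (W → Spec k) ≫ p`, `h_p ≫ pr₂ = 𝟙`. [folklore] -/
theorem slice_fst_snd :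
    pullback.lift (W.hom ≫ p) (𝟙 W.left) (slice_condition p hp W) ≫ pullback.fst X.hom W.hom =
      W.hom ≫ p ∧
    pullback.lift (W.hom ≫ p) (𝟙 W.left) (slice_condition p hp W) ≫ pullback.snd X.hom W.hom =
      𝟙 W.left :=
  ⟨pullback.lift_fst _ _ _, pullback.lift_snd _ _ _⟩

/-- The slice is a morphism over `Spec k`: `h_p ≫ (X ⊗ W → Spec k) = (W → Spec k)`. [folklore] -/
theorem slice_comp_hom :
    pullback.lift (W.hom ≫ p) (𝟙 W.left) (slice_condition p hp W) ≫ (X ⊗ W).hom = W.hom := by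
  change _ ≫ pullback.fst X.hom W.hom ≫ X.hom = _
  rw [← Category.assoc, (slice_fst_snd p hp W).1, Category.assoc, hp, Category.comp_id]

/-- **The slice over a rational point is a closed immersion** (a section of the separated
projection `pr₂ : X ⊗ W → W`). [folklore] -/
theorem isClosedImmersion_slice [IsSeparated X.hom] :
    IsClosedImmersion (pullback.lift (W.hom ≫ p) (𝟙 W.left) (slice_condition p hp W)) := by
  haveI : IsClosedImmersion (pullback.lift (W.hom ≫ p) (𝟙 W.left) (slice_condition p hp W) ≫
      pullback.snd X.hom W.hom) := by
    rw [(slice_fst_snd p hp W).2]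
    infer_instance
  exact IsClosedImmersion.of_comp _ (pullback.snd X.hom W.hom)

/-- **The slice is killed by `pr₁⁻¹K` whenever the point is killed by `K`.**
[cite: ShiodaKatsura1979, §1 (1.6)] -/
theorem comap_slice_eq_bot (K : X.left.IdealSheafData) (hK : K.comap p = ⊥) :
    (K.comap (pullback.fst X.hom W.hom)).comap
      (pullback.lift (W.hom ≫ p) (𝟙 W.left) (slice_condition p hp W)) = ⊥ := by
  rw [← Scheme.IdealSheafData.comap_comp, (slice_fst_snd p hp W).1, Scheme.IdealSheafData.comap_comp,
    hK]
  exact (Scheme.IdealSheafData.map_gc _).l_bot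

/-- The range of a rational point is the single point `p(∗)`. [folklore] -/
theorem range_point_left : Set.range p = {p (IsLocalRing.closedPoint k)} := by
  haveI : Subsingleton ↥(Spec (CommRingCat.of k)) := inferInstanceAs (Subsingleton (PrimeSpectrum k))
  ext x
  constructor
  · rintro ⟨y, rfl⟩
    obtain rfl : y = IsLocalRing.closedPoint k := Subsingleton.elim _ _
    rfl
  · rintro rfl
    exact ⟨_, rfl⟩

/-- The slice square `W → X ⊗ W → X`, `W → Spec k → X` is cartesian. [folklore] -/
theorem isPullback_slice :
    IsPullback (pullback.lift (W.hom ≫ p) (𝟙 W.left) (slice_condition p hp W)) W.hom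
      (pullback.fst X.hom W.hom) p := by
  refine IsPullback.of_right ?_ (slice_fst_snd p hp W).1 (IsPullback.of_hasPullback X.hom W.hom).flip
  rw [(slice_fst_snd p hp W).2, hp]
  exact IsPullback.of_horiz_isIso ⟨by rw [Category.id_comp, Category.comp_id]⟩

/-- **The image of the slice is the fibre `pr₁⁻¹{p(∗)}`.** [cite: ShiodaKatsura1979, §1 (1.6)] -/
theorem range_slice :
    Set.range (pullback.lift (W.hom ≫ p) (𝟙 W.left) (slice_condition p hp W)) =
      pullback.fst X.hom W.hom ⁻¹' {p (IsLocalRing.closedPoint k)} := by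
  have h := isPullback_slice p hp W
  rw [← h.isoPullback_hom_fst, Scheme.Hom.comp_base, TopCat.coe_comp,
    h.isoPullback.hom.surjective.range_comp, Scheme.Pullback.range_fst, range_point_left]

/-- **A rational point on the image of a closed immersion is killed by its kernel**: `p` factors
through the closed immersion `g` (`Spec k` being reduced, `liftOfRangeSubset`), so
`(ker g) · 𝒪_{Spec k} = 0`. [folklore] -/
theorem comap_point_eq_bot_of_mem_range {Y : SchemeOver k} (g : Y ⟶ X) [IsClosedImmersion g.left]
    (hp : p (IsLocalRing.closedPoint k) ∈ Set.range g.left) :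
    g.left.ker.comap p = ⊥ := by
  have hsub : Set.range p ⊆ Set.range g.left := by
    rw [range_point_left]
    exact Set.singleton_subset_iff.mpr hp
  rw [← liftOfRangeSubset_comp g.left p hsub, Scheme.IdealSheafData.comap_comp,
    comap_ker_self_eq_bot]
  exact (Scheme.IdealSheafData.map_gc _).l_bot

end Literature.AlgebraicGeometry.Motives

end
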